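import Literature.NumberTheory.PAdicHodge.TatePairingPointOfKTwo
import Literature.NumberTheory.PAdicHodge.KummerFilZeroCoboundaryRamifiedOfWeil
import HarnessLib

/-!
# Kato's reciprocity law modulo (K₂) with the K1 period maps `(∫ω, ∫η)` over the ramified base (instantiation of the capstone)

Topic `Literature/NumberTheory/PAdicHodge`; THEOREMS ONLY (no definition, no named fact, no instance, no `sorry`). Gap 6 of memo
`Cruxes/StarredOptimalManinUnitFiveSeven/Lines/kato-lever-K3-legendre.md` §4: the capstone
`TatePairingPointOfKTwo.exists_const_tatePairingPoint_eq_neg_trace_of_KTwo` INSTANTIATED with the hT₂/K1 programme's period maps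
`Pω := ∫ω ∘ e`, `Pη := ∫η ∘ e` (`AinfRamTop.omegaPeriodHomO / etaPeriodHomO` through a Galois matching `e : T_pW₀ ≃ T_pŴ♭(𝒪_ℂ)`,
exactly the data of `KummerFilZeroCoboundaryRamifiedOfWeil`): their `ℤ_p`-homogeneity (`…_smul'`), equivariance (`gal_…`), `∫ω ⊆ Fil¹`
(`omegaPeriodHomO_mem_filOne`) are tree theorems, the non-vanishing witnesses `hN1`, `hNη` are the ones the K1 capstones produce on the
cells (`exists_omegaPeriodHomO_ne_zero`, `exists_etaPeriodHomO_not_mem_filOne`).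

★★★ `exists_const_tatePairingPoint_eq_neg_trace_of_KTwo_of_matching` — at `F = K_v`: ONE pair of constants `(c_L ≠ 0, c)` such that for every
cocycle `η`, every point `P` with Kummer cocycle `κ`, every integrating pair `(b_ω, b_η)` of `κ` for `(∫ω∘e, ∫η∘e)` with `θ(b_ω) = ι(c_P)`
(K1: `exists_integratingPair_kummerCocycleO` + `BdRPlusFormalLogBOmega`, `c_P = log_ω P`): (K₂) for the rescaled Legendre resolution ⟹
`⟨[η], P⟩ = −Tr_{F/ℚ_p}(c_P · exp*_d(η) · c)`. BSD / K★ / [REC] are NOT proved by this file; (K₂) is the research residue.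

## References
* K. Kato, LNM 1553 (1993), Ch. II Thm. 1.4.1, Lemma 1.4.3. [Kato1993LNM1553]
* P. Colmez, Math. Ann. 292 (1992), §2. [Colmez1992PeriodesAbeliennes]
* J.-M. Fontaine, Invent. Math. 65 (1982), §5. [Fontaine1982FormesDifferentielles]
-/

noncomputable section

open Field Function ValuativeRel WittVector NumberField IsDedekindDomain
open scoped NumberField Topology

namespace Literature.NumberTheory.PAdicHodge

open Literature.NumberTheory.GaloisRepresentations
open Literature.NumberTheory.GaloisRepresentations.IsNonarchimedeanLocalField
open Literature.NumberTheory.GaloisCohomology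
open Literature.NumberTheory.EllipticCurves
open Literature.NumberTheory.PAdicHodge.GaloisContinuity
open Literature.IUT.LogVolume
open _root_.WeierstrassCurve

section Completion

variable {K : Type} [Field K] [NumberField K] {p : ℕ} [hprime : Fact p.Prime] (v : HeightOneSpectrum (𝓞 K))
  [CharZero (v.adicCompletion K)] [LocallyCompactSpace (absoluteGaloisGroup (v.adicCompletion K))]
  [Fact (¬ IsUnit (p : integerC (v.adicCompletion K)))]
  [IsAdicComplete (Ideal.span {(p : integerC (v.adicCompletion K))}) (integerC (v.adicCompletion K))]
  {K₀ : Type} [Field K₀] [CharZero K₀] (W : WeierstrassCurve K₀) [W.IsElliptic] [Algebra K₀ (v.adicCompletion K)]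
  (e : (k : ℕ) → geomTorsion W ((p ^ k : ℕ) : ℤ) → geomTorsion W ((p ^ k : ℕ) : ℤ) → AlgebraicClosure K₀)
  (hμ : ∀ k S T, e k S T ^ (p ^ k) = 1) (hadd₁ : ∀ k S₁ S₂ T, e k (S₁ + S₂) T = e k S₁ T * e k S₂ T)
  (hadd₂ : ∀ k S T₁ T₂, e k S (T₁ + T₂) = e k S T₁ * e k S T₂)
  (hgal : ∀ k (σ : absoluteGaloisGroup K₀) (S T : geomTorsion W ((p ^ k : ℕ) : ℤ)), σ • e k S T = e k (σ • S) (σ • T))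
  (hcompat : ∀ k (S T : geomTorsion W ((p ^ (k + 1) : ℕ) : ℤ)),
    e k (torsionMulHom W (p ^ (k + 1)) (p ^ k) p (pow_succ p k).symm S)
      (torsionMulHom W (p ^ (k + 1)) (p ^ k) p (pow_succ p k).symm T) = e (k + 1) S T ^ p)

set_option maxHeartbeats 800000 in
include hgal in
/-- ★★★ **Kato's reciprocity law at a completion modulo (K₂), with the K1 period maps.** See the module docstring.
[cite: Kato1993LNM1553, Ch. II Thm. 1.4.1 (3)–(4) and Lemma 1.4.3] [cite: Colmez1992PeriodesAbeliennes, §2]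
[cite: Fontaine1982FormesDifferentielles, §5] -/
theorem exists_const_tatePairingPoint_eq_neg_trace_of_KTwo_of_matching
    (hpv : valuation (v.adicCompletion K) (p : v.adicCompletion K) < 1)
    (Dv : EisensteinRoot (v.adicCompletion K) p hpv) (Wm : WeierstrassCurve (EisensteinRoot.CoeffDisc Dv))
    (ψm : EisensteinRoot.CoeffDisc Dv →+* LTCoeff (v.adicCompletion K))
    (hψm : ∀ c, algebraMap (LTCoeff (v.adicCompletion K)) (v.adicCompletion K) (ψm c) = EisensteinRoot.CoeffDisc.toF Dv c)
    (em : W.tateModule p ≃ₗ[ℤ_[p]] AinfTop.TatePtO (v.adicCompletion K) (Wm.map ψm) p)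
    (hem : ∀ (σ : absoluteGaloisGroup (v.adicCompletion K)) (a : W.tateModule p), em (absGaloisRestrict K₀ (v.adicCompletion K) σ • a) = σ • em a)
    (hN1 : ∃ τ, AinfRamTop.omegaPeriodHomO Wm ψm (surjective_fontaineTheta_integerC hpv) hψm τ ≠ 0)
    (hNη : ∃ τ, AinfRamTop.etaPeriodHomO Wm ψm (surjective_fontaineTheta_integerC hpv) hψm τ ∉ (BdRPlusTop.filOne (v.adicCompletion K) p).toIdeal)
    (ψ : C(absoluteGaloisGroup (v.adicCompletion K), ℤ_[p])) (hψ : ∀ σ τ, ψ (σ * τ) = ψ σ + ψ τ)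
    (hψlog : ∀ τ, (ψ τ : ℚ_[p]) = logCyclotomic (F := v.adicCompletion K) p τ)
    (heL : ∀ (c : ℤ_[p]) (S U : W.tateModule p), (weilContPairingPadic W (v.adicCompletion K) p e hμ hadd₁ hadd₂ hgal hcompat).toLin (c • S) U =
      twistHom (v.adicCompletion K) p ((weilContPairingPadic W (v.adicCompletion K) p e hμ hadd₁ hadd₂ hgal hcompat).toLin S U) c)
    (healt : ∀ S : W.tateModule p, (weilContPairingPadic W (v.adicCompletion K) p e hμ hadd₁ hadd₂ hgal hcompat).toLin S S = 0)
    (henondeg : ∀ S : W.tateModule p,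
      (∀ U, (weilContPairingPadic W (v.adicCompletion K) p e hμ hadd₁ hadd₂ hgal hcompat).toLin S U = 0) → S = 0)
    (hinj : letI := LocalField.padicAlgebra (v.adicCompletion K) p hpv
      (bdRPeriodRingData (F := v.adicCompletion K) (p := p) hpv).CupLogInjective (logCyclotomic p) (restrictedRationalTateRep W (v.adicCompletion K) p))
    (hde : letI := LocalField.padicAlgebra (v.adicCompletion K) p hpv
      ∀ η : contOneCocycles (restrictedTateRep W (v.adicCompletion K) p).toTopRep,
        (bdRPeriodRingData (F := v.adicCompletion K) (p := p) hpv).HasDualExp (logCyclotomic p) (restrictedRationalTateRep W (v.adicCompletion K) p)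
          fun σ => TateModule.toRational p (η.1 σ))
    (d : letI := LocalField.padicAlgebra (v.adicCompletion K) p hpv
      (bdRPeriodRingData (F := v.adicCompletion K) (p := p) hpv).FilZeroLine (restrictedRationalTateRep W (v.adicCompletion K) p)) :
    letI := LocalField.padicAlgebra (v.adicCompletion K) p hpv
    let hF := surjective_fontaineTheta_integerC hpv
    let Pω : W.tateModule p →+ BdRPlusTop (v.adicCompletion K) p := (AinfRamTop.omegaPeriodHomO Wm ψm hF hψm).comp em.toAddMonoidHom
    let Pη : W.tateModule p →+ BdRPlusTop (v.adicCompletion K) p := (AinfRamTop.etaPeriodHomO Wm ψm hF hψm).comp em.toAddMonoidHom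
    ∃ (cL c : v.adicCompletion K), cL ≠ 0 ∧
      (∀ S U : W.tateModule p, Pω S * Pη U - Pη S * Pω U = BdRPlusTop.of (v.adicCompletion K) p (embBdRHom hpv hF cL) *
        BdRPlusTop.periodLine (v.adicCompletion K) p ((weilContPairingPadic W (v.adicCompletion K) p e hμ hadd₁ hadd₂ hgal hcompat).toLin S U)) ∧
      ∀ (η κ : contOneCocycles (restrictedTateRep W (v.adicCompletion K) p).toTopRep) (P : (W.baseChange (v.adicCompletion K)).toAffine.Point),
        (∀ j, (cohomologyMap (tateProjMor W (v.adicCompletion K) p j) 1).hom (oneCocycleClass _ κ) = kummerLevelClass W (v.adicCompletion K) p j P) →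
        ∀ (bω bη : BdRPlusTop (v.adicCompletion K) p) (cP : v.adicCompletion K),
          (∀ τ, Pω (κ.1 τ) = BdRPlusTop.gal (v.adicCompletion K) p τ bω - bω) → (∀ τ, Pη (κ.1 τ) = BdRPlusTop.gal (v.adicCompletion K) p τ bη - bη) →
          thetaBdR ((BdRPlusTop.of (v.adicCompletion K) p).symm bω) = algebraMap (v.adicCompletion K) (CompletedAlgClosure (v.adicCompletion K)) cP →
          ∀ N : ℕ,
            (∀ σ, IsTeichLog 2 ((BdRPlusTop.of (v.adicCompletion K) p).symm ((p : BdRPlusTop (v.adicCompletion K) p) ^ N *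
              (BdRPlusTop.of (v.adicCompletion K) p (embBdRHom hpv hF cL⁻¹) * Pη (η.1 σ) * bω -
                Pω (η.1 σ) * (BdRPlusTop.of (v.adicCompletion K) p (embBdRHom hpv hF cL⁻¹) * bη))))) →
            (∀ M' : ℕ, ∀ᶠ σ in 𝓝 (1 : absoluteGaloisGroup (v.adicCompletion K)), ∃ L' : BDeRhamPlus (integerC (v.adicCompletion K)) p, IsTeichLog 2 L' ∧
              (BdRPlusTop.of (v.adicCompletion K) p).symm ((p : BdRPlusTop (v.adicCompletion K) p) ^ N *
                (BdRPlusTop.of (v.adicCompletion K) p (embBdRHom hpv hF cL⁻¹) * Pη (η.1 σ) * bω -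
                  Pω (η.1 σ) * (BdRPlusTop.of (v.adicCompletion K) p (embBdRHom hpv hF cL⁻¹) * bη))) -
                (p : BDeRhamPlus (integerC (v.adicCompletion K)) p) ^ M' * L' ∈ Ideal.span {(xiBdR : BDeRhamPlus (integerC (v.adicCompletion K)) p) ^ 2}) →
            ((tatePairingPoint W (v.adicCompletion K) p e hμ hadd₁ hadd₂ hgal hcompat (oneCocycleClass _ η) P : ℤ_[p]) : ℚ_[p]) =
              -Algebra.trace ℚ_[p] (v.adicCompletion K) (cP * (expStarCoord W hpv d η * c)) := by
  intro hF Pω Pη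
  have hPωapp : ∀ a, Pω a = AinfRamTop.omegaPeriodHomO Wm ψm hF hψm (em a) := fun _ => rfl
  have hPηapp : ∀ a, Pη a = AinfRamTop.etaPeriodHomO Wm ψm hF hψm (em a) := fun _ => rfl
  have hPωZ : ∀ (c : ℤ_[p]) (a : W.tateModule p), Pω (c • a) = BdRPlusTop.of (v.adicCompletion K) p (qpToBdR (c : ℚ_[p])) * Pω a :=
    fun c a => by rw [hPωapp, hPωapp, map_smul, AinfRamTop.omegaPeriodHomO_smul']
  have hPηZ : ∀ (c : ℤ_[p]) (a : W.tateModule p), Pη (c • a) = BdRPlusTop.of (v.adicCompletion K) p (qpToBdR (c : ℚ_[p])) * Pη a :=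
    fun c a => by rw [hPηapp, hPηapp, map_smul, AinfRamTop.etaPeriodHomO_smul']
  have hPω : ∀ (σ : absoluteGaloisGroup (v.adicCompletion K)) (a : W.tateModule p),
      BdRPlusTop.gal (v.adicCompletion K) p σ (Pω a) = Pω (restrictedTateRep W (v.adicCompletion K) p σ a) := fun σ a => by
    rw [hPωapp, hPωapp, AinfRamTop.gal_omegaPeriodHomO, restrictedTateRep_apply_apply, hem]
  have hPη : ∀ (σ : absoluteGaloisGroup (v.adicCompletion K)) (a : W.tateModule p),
      BdRPlusTop.gal (v.adicCompletion K) p σ (Pη a) = Pη (restrictedTateRep W (v.adicCompletion K) p σ a) := fun σ a => by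
    rw [hPηapp, hPηapp, AinfRamTop.gal_etaPeriodHomO, restrictedTateRep_apply_apply, hem]
  have hfil : ∀ a, Pω a ∈ (BdRPlusTop.filOne (v.adicCompletion K) p).toIdeal := fun a => by
    rw [hPωapp]; exact AinfRamTop.omegaPeriodHomO_mem_filOne Wm ψm _
  have hne : ∃ a, Pω a ≠ 0 := by
    obtain ⟨τ, hτ⟩ := hN1
    exact ⟨em.symm τ, by rwa [hPωapp, LinearEquiv.apply_symm_apply]⟩
  have hnot : ∃ a, Pη a ∉ (BdRPlusTop.filOne (v.adicCompletion K) p).toIdeal := by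
    obtain ⟨τ, hτ⟩ := hNη
    exact ⟨em.symm τ, by rwa [hPηapp, LinearEquiv.apply_symm_apply]⟩
  exact exists_const_tatePairingPoint_eq_neg_trace_of_KTwo v W e hμ hadd₁ hadd₂ hgal hcompat hpv hF ψ hψ hψlog hPωZ hPηZ hPω hPη
    hfil hne hnot heL healt henondeg hinj hde d

end Completion

end Literature.NumberTheory.PAdicHodge

end
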